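import Summits.Schanuel.Schanuel.Theses.RigidCore
import Literature.NumberTheory.Transcendental.ExpPointsExamples
import Literature.NumberTheory.Transcendental.RationalCoordRelations
import Literature.NumberTheory.Transcendental.CuspSlopeAlgebraic
import Literature.NumberTheory.Transcendental.BivariateBridge

/-!
# The slope of a linear cusp of a `ℚ`-curve is algebraic (split of `RigidCore.SparsityTwo`, part 1)

Helper for the line `cusp-germ-schneider-sparsity` of the crux `RigidCore.SparsityTwo`
(item stmt-Schanuel-0971, route route-Schanuel-RigidCore); first file of the landed SPLIT
`SparsityTwo ⇐ {A1, A2, A3}` (files `RigidCoreSparsityTwoSplit*.lean`, `RigidCoreSparsityTwoOfAtoms.lean`).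

On a normalised log-free cusp ray `σ ↦ ((2πi σ⁻ᵉ + ℓu σ, 2πi (A(σ⁻¹) + g σ) + ℓv σ) ∘ s, (e^{ℓu σ}, e^{ℓv σ}) ∘ s)`
of a `ℚ`-closed `W ⊆ ℂ² × ℂ²` of dimension `< 2`, with polar jet `A` of degree `≤ e`, the two additive
coordinates `u, v` satisfy a non-zero RATIONAL relation `Q(u, v) = 0` (tree
`exists_rat_relation_pair_of_zariskiDim_lt_two`, `exists_bivariate_of_mvPolynomial`), `‖u‖ → ∞` and
`v/u → A.coeff e` along `σ_n = ρ/(n+2)`; the asymptotic lemma `isAlgebraic_of_tendsto_div_of_eval₂_eq_zero`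
(`CuspSlopeAlgebraic`) makes the slope `A.coeff e` algebraic. Moved verbatim from the lead's skeleton
(`Cruxes/SparsityTwo/Lines/cusp_germ_schneider_sparsity.lean`, gen 0 reshape 2) so that the split is importable.
No unproved facts; axioms standard.
-/

set_option linter.dupNamespace false

namespace Summit.Schanuel.Schanuel.Cruxes.SparsityTwo.CuspGermSchneiderSparsity

open Filter Topology Complex Polynomial Literature.NumberTheory.Transcendental
open scoped Real

/-- **The slope of a linear cusp is algebraic.** On a normalised log-free cusp ray of a ℚ-closed `W`
of dimension `< 2` with jet `A` of degree `≤ e` (so that `x_{i'}/x_i → A.coeff e`), the slope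
`A.coeff e` is an algebraic number (`CuspSlopeAlgebraic` applied to the rational relation between the
two additive coordinates). For `deg A < e` the statement is empty (`A.coeff e = 0`). -/
theorem cusp_slope_isAlgebraic
    (W : Set (Fin 2 ⊕ Fin 2 → ℂ)) (hW : IsDefinedOver (⊥ : Subfield ℂ) W) (hdim : zariskiDim ℂ W < 2)
    (s : Fin 2 ≃ Fin 2) (e : ℕ) (A : Polynomial ℂ) (g ℓu ℓv : ℂ → ℂ) (ρ : ℝ)
    (he : 0 < e) (hρ : 0 < ρ) (hg : AnalyticAt ℂ g 0) (hg0 : g 0 = 0)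
    (hu : AnalyticAt ℂ ℓu 0) (hv : AnalyticAt ℂ ℓv 0)
    (hbr : ∀ σ : ℂ, 0 < ‖σ‖ → ‖σ‖ < ρ →
      Sum.elim ((![2 * ↑π * I * σ⁻¹ ^ e + ℓu σ,
                    2 * ↑π * I * (A.eval σ⁻¹ + g σ) + ℓv σ] : Fin 2 → ℂ) ∘ s)
        ((![Complex.exp (ℓu σ), Complex.exp (ℓv σ)] : Fin 2 → ℂ) ∘ s) ∈ W)
    (hdeg : A.natDegree ≤ e) :
    IsAlgebraic ℚ (A.coeff e) := by
  -- the sample points `σ_n = ρ/(n+2)` in the punctured disc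
  set σ : ℕ → ℂ := fun n => ((ρ / ((n : ℝ) + 2) : ℝ) : ℂ) with hσ
  have hσnorm : ∀ n, ‖σ n‖ = ρ / ((n : ℝ) + 2) := fun n => by
    rw [hσ]; simp only [Complex.norm_real, Real.norm_eq_abs]
    exact abs_of_pos (by positivity)
  have hσpos : ∀ n, 0 < ‖σ n‖ := fun n => by rw [hσnorm]; positivity
  have hσlt : ∀ n, ‖σ n‖ < ρ := fun n => by
    rw [hσnorm, div_lt_iff₀ (by positivity)]
    nlinarith
  have hσne : ∀ n, σ n ≠ 0 := fun n => norm_pos_iff.mp (hσpos n)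
  have hσlim : Tendsto σ atTop (𝓝 0) := by
    have h0 : Tendsto (fun n => ‖σ n‖) atTop (𝓝 0) := by
      have h1 : Tendsto (fun n : ℕ => ρ / ((n : ℝ) + 2)) atTop (𝓝 0) := by
        have := (tendsto_const_div_atTop_nhds_zero_nat ρ).comp (tendsto_add_atTop_nat 2)
        refine this.congr fun n => ?_
        simp only [Function.comp_apply, Nat.cast_add, Nat.cast_ofNat]
      exact h1.congr fun n => (hσnorm n).symm
    exact tendsto_zero_iff_norm_tendsto_zero.mpr h0
  have hℓu : Tendsto (fun n => ℓu (σ n)) atTop (𝓝 (ℓu 0)) :=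
    (hu.continuousAt.tendsto).comp hσlim
  have hℓv : Tendsto (fun n => ℓv (σ n)) atTop (𝓝 (ℓv 0)) :=
    (hv.continuousAt.tendsto).comp hσlim
  have hgl : Tendsto (fun n => g (σ n)) atTop (𝓝 0) := by
    have := (hg.continuousAt.tendsto).comp hσlim
    rwa [hg0] at this
  have hpow : Tendsto (fun n => (σ n) ^ e) atTop (𝓝 0) := by
    have := hσlim.pow e
    rwa [zero_pow he.ne'] at this
  -- the two additive coordinates along `σ n`
  set u : ℕ → ℂ := fun n => 2 * ↑π * I * (σ n)⁻¹ ^ e + ℓu (σ n) with hudef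
  set v : ℕ → ℂ := fun n => 2 * ↑π * I * (A.eval (σ n)⁻¹ + g (σ n)) + ℓv (σ n) with hvdef
  -- `u` is unbounded (as in `cusp_values_isAlgebraic`)
  have hularge : Tendsto (fun n => ‖u n‖) atTop atTop := by
    have hmain : Tendsto (fun n => ‖2 * ↑π * I * (σ n)⁻¹ ^ e‖) atTop atTop := by
      have h1 : Tendsto (fun n : ℕ => ((n : ℝ) + 2) / ρ) atTop atTop :=
        Tendsto.atTop_div_const hρ (tendsto_natCast_atTop_atTop.atTop_add tendsto_const_nhds)
      have h2 : Tendsto (fun n : ℕ => (2 * π) * (((n : ℝ) + 2) / ρ) ^ e) atTop atTop :=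
        Tendsto.const_mul_atTop (by positivity) ((tendsto_pow_atTop he.ne') |>.comp h1)
      refine h2.congr fun n => ?_
      rw [norm_mul, norm_mul, norm_mul, norm_pow, norm_inv, hσnorm n, Complex.norm_I,
        Complex.norm_real, Real.norm_eq_abs, abs_of_pos Real.pi_pos, inv_div]
      norm_num
    have hbd : ∀ᶠ n in atTop, ‖ℓu (σ n)‖ ≤ ‖ℓu 0‖ + 1 := by
      have := hℓu.norm
      exact (this.eventually (gt_mem_nhds (lt_add_one _))).mono fun n hn => hn.le
    have hlow : ∀ᶠ n in atTop, ‖2 * ↑π * I * (σ n)⁻¹ ^ e‖ - (‖ℓu 0‖ + 1) ≤ ‖u n‖ := by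
      filter_upwards [hbd] with n hn
      have : ‖2 * ↑π * I * (σ n)⁻¹ ^ e‖ ≤ ‖u n‖ + ‖ℓu (σ n)‖ := by
        have h := norm_add_le (u n) (-ℓu (σ n))
        have huv : u n + -ℓu (σ n) = 2 * ↑π * I * (σ n)⁻¹ ^ e := by rw [hudef]; ring
        rw [huv, norm_neg] at h
        exact h
      linarith
    refine tendsto_atTop_mono' atTop hlow ?_
    exact tendsto_atTop_add_const_right _ _ hmain
  -- the ratio `v/u → A.coeff e`
  have hf : Tendsto (fun n => (σ n) ^ e * A.eval (σ n)⁻¹) atTop (𝓝 (A.coeff e)) := by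
    have hterm : ∀ k ∈ Finset.range (A.natDegree + 1),
        Tendsto (fun n => A.coeff k * (σ n) ^ (e - k)) atTop
          (𝓝 (if k = e then A.coeff e else 0)) := by
      intro k hk
      rw [Finset.mem_range] at hk
      by_cases hke : k = e
      · subst hke
        simp only [if_true, Nat.sub_self, pow_zero, mul_one]
        exact tendsto_const_nhds
      · rw [if_neg hke]
        have hlt : 0 < e - k := Nat.sub_pos_of_lt (lt_of_le_of_ne (by omega) hke)
        have := (hσlim.pow (e - k)).const_mul (A.coeff k)
        rwa [zero_pow hlt.ne', mul_zero] at this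
    have hsum := tendsto_finsetSum (Finset.range (A.natDegree + 1)) hterm
    have hlim : (∑ k ∈ Finset.range (A.natDegree + 1), (if k = e then A.coeff e else 0)) =
        A.coeff e := by
      rw [Finset.sum_ite_eq' (Finset.range (A.natDegree + 1)) e (fun _ => A.coeff e)]
      split_ifs with hmem
      · rfl
      · rw [Finset.mem_range, not_lt] at hmem
        exact (Polynomial.coeff_eq_zero_of_natDegree_lt (by omega)).symm
    rw [hlim] at hsum
    refine hsum.congr' ?_
    filter_upwards [eventually_gt_atTop 0] with n _
    rw [Polynomial.eval_eq_sum_range, Finset.mul_sum]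
    refine Finset.sum_congr rfl fun k hk => ?_
    rw [Finset.mem_range] at hk
    have hke : k ≤ e := by omega
    rw [inv_pow, pow_sub₀ _ (hσne n) hke]
    ring
  have hratio : Tendsto (fun n => v n / u n) atTop (𝓝 (A.coeff e)) := by
    have hnum : Tendsto (fun n => 2 * ↑π * I * ((σ n) ^ e * A.eval (σ n)⁻¹) +
        (σ n) ^ e * (2 * ↑π * I * g (σ n) + ℓv (σ n))) atTop
        (𝓝 (2 * ↑π * I * A.coeff e + 0 * (2 * ↑π * I * 0 + ℓv 0))) :=
      (hf.const_mul _).add (hpow.mul ((hgl.const_mul _).add hℓv))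
    have hden : Tendsto (fun n => 2 * ↑π * I + (σ n) ^ e * ℓu (σ n)) atTop
        (𝓝 (2 * ↑π * I + 0 * ℓu 0)) :=
      tendsto_const_nhds.add (hpow.mul hℓu)
    have h2πI : (2 * ↑π * I : ℂ) ≠ 0 := by
      simp [Real.pi_ne_zero, Complex.I_ne_zero]
    have hden0 : (2 * ↑π * I + 0 * ℓu 0 : ℂ) ≠ 0 := by rwa [zero_mul, add_zero]
    have := hnum.div hden hden0
    rw [zero_mul, add_zero, zero_mul, add_zero, mul_div_cancel_left₀ _ h2πI] at this
    refine this.congr' ?_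
    filter_upwards [hularge.eventually (eventually_ge_atTop 1)] with n hn
    have hun : u n ≠ 0 := by
      intro h0; rw [h0, norm_zero] at hn; linarith
    have hσe : (σ n) ^ e ≠ 0 := pow_ne_zero _ (hσne n)
    have hden_eq : 2 * ↑π * I + (σ n) ^ e * ℓu (σ n) = (σ n) ^ e * u n := by
      rw [hudef]; simp only; rw [inv_pow]; field_simp
    have hnum_eq : 2 * ↑π * I * ((σ n) ^ e * A.eval (σ n)⁻¹) +
        (σ n) ^ e * (2 * ↑π * I * g (σ n) + ℓv (σ n)) = (σ n) ^ e * v n := by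
      rw [hvdef]; ring
    rw [Pi.div_apply, hnum_eq, hden_eq, mul_div_mul_left _ _ hσe]
  -- the rational relation between the two additive coordinates, in iterated form
  obtain ⟨R, hR0, hRW⟩ := exists_rat_relation_pair_of_zariskiDim_lt_two W hW hdim
    (Sum.inl (s.symm 0)) (Sum.inl (s.symm 1))
  obtain ⟨Q, hQ0, hQ⟩ := exists_bivariate_of_mvPolynomial R hR0
  refine isAlgebraic_of_tendsto_div_of_eval₂_eq_zero Q hQ0 hularge hratio fun n => ?_
  rw [hQ]
  have hz := hRW _ (hbr (σ n) (hσpos n) (hσlt n))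
  simpa [hudef, hvdef] using hz

/-- **Registered form** (`stub_splitSlope`, one-line signature for the ledger): the slope of a linear cusp of a
`ℚ`-closed `W` of dimension `< 2` is algebraic — `cusp_slope_isAlgebraic` with all hypotheses as arrows. -/
theorem stub_splitSlope :
    ∀ (W : Set (Fin 2 ⊕ Fin 2 → ℂ)), IsDefinedOver (⊥ : Subfield ℂ) W → zariskiDim ℂ W < 2 →
      ∀ (s : Fin 2 ≃ Fin 2) (e : ℕ) (A : Polynomial ℂ) (g ℓu ℓv : ℂ → ℂ) (ρ : ℝ),
        0 < e → 0 < ρ → AnalyticAt ℂ g 0 → g 0 = 0 → AnalyticAt ℂ ℓu 0 → AnalyticAt ℂ ℓv 0 →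
        (∀ σ : ℂ, 0 < ‖σ‖ → ‖σ‖ < ρ →
          Sum.elim ((![2 * ↑π * I * σ⁻¹ ^ e + ℓu σ,
                        2 * ↑π * I * (A.eval σ⁻¹ + g σ) + ℓv σ] : Fin 2 → ℂ) ∘ s)
            ((![Complex.exp (ℓu σ), Complex.exp (ℓv σ)] : Fin 2 → ℂ) ∘ s) ∈ W) →
        A.natDegree ≤ e → IsAlgebraic ℚ (A.coeff e) :=
  cusp_slope_isAlgebraic


/-! ## Appended (lead c2, 2026-08-16): the slope of a cusp with LINEAR-JET normal form is algebraic -/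

/-- **The slope of a linear jet is algebraic.** If the polar jet of a normalised log-free cusp ray of a `ℚ`-closed `W` of
dimension `< 2` has the linear-jet normal form `A = β X^e + a₀` (`e ≥ 1`; `linearJet_normalForm` of
`RigidCoreSparsityTwoSplitLemmas`), then `β` is algebraic: `A.coeff e = β`, `deg A ≤ e`, and `cusp_slope_isAlgebraic`. This is the
only place where the split's linear-jet case uses `W`. -/
theorem cusp_slope_isAlgebraic_of_eq_linearJet
    (W : Set (Fin 2 ⊕ Fin 2 → ℂ)) (hW : IsDefinedOver (⊥ : Subfield ℂ) W) (hdim : zariskiDim ℂ W < 2)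
    (s : Fin 2 ≃ Fin 2) (e : ℕ) (A : Polynomial ℂ) (g ℓu ℓv : ℂ → ℂ) (ρ : ℝ)
    (he : 0 < e) (hρ : 0 < ρ) (hg : AnalyticAt ℂ g 0) (hg0 : g 0 = 0)
    (hu : AnalyticAt ℂ ℓu 0) (hv : AnalyticAt ℂ ℓv 0)
    (hbr : ∀ σ : ℂ, 0 < ‖σ‖ → ‖σ‖ < ρ →
      Sum.elim ((![2 * ↑π * I * σ⁻¹ ^ e + ℓu σ,
                    2 * ↑π * I * (A.eval σ⁻¹ + g σ) + ℓv σ] : Fin 2 → ℂ) ∘ s)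
        ((![Complex.exp (ℓu σ), Complex.exp (ℓv σ)] : Fin 2 → ℂ) ∘ s) ∈ W)
    {β a₀ : ℂ} (hA : A = Polynomial.C β * Polynomial.X ^ e + Polynomial.C a₀) :
    IsAlgebraic ℚ β := by
  have hAcoeff : A.coeff e = β := by
    rw [hA, Polynomial.coeff_add, Polynomial.coeff_C_mul, Polynomial.coeff_X_pow_self, Polynomial.coeff_C,
      if_neg he.ne']
    ring
  have hAdeg : A.natDegree ≤ e := by
    rw [hA]
    refine (Polynomial.natDegree_add_le _ _).trans (max_le ?_ ?_)
    · exact Polynomial.natDegree_C_mul_X_pow_le β e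
    · simp
  rw [← hAcoeff]
  exact cusp_slope_isAlgebraic W hW hdim s e A g ℓu ℓv ρ he hρ hg hg0 hu hv hbr hAdeg

end Summit.Schanuel.Schanuel.Cruxes.SparsityTwo.CuspGermSchneiderSparsity
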